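import Mathlib.Analysis.Calculus.ParametricIntegral
import Mathlib.Analysis.Calculus.ContDiff.FiniteDimension
import Mathlib.Analysis.Calculus.FDeriv.Prod
import Mathlib.MeasureTheory.Integral.Bochner.ContinuousLinearMap
import Mathlib.Analysis.InnerProductSpace.Laplacian
import Literature.Analysis.PDE.NewtonianPotential
import Literature.Analysis.PDE.LoewnerNirenberg
import Literature.Analysis.Calculus.SmoothKernelIntegral
import Literature.Analysis.FluidPDE.HessianLaplacian
import HarnessLib

/-!
# The Poisson kernel of a ball in a finite-dimensional real inner product space, I:
# smooth parametric integrals and the harmonicity of the kernel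

Analysis/PDE support file (definitions with bodies and PROVED theorems only; no named facts) on
the discharge path of `Literature.Analysis.PDE.LoewnerNirenberg.exists_isMaximalSolution`
(Perron's method needs the Dirichlet problem for the Laplacian on small balls; it is solved in
`PoissonBall.lean` by a POISSON OPERATOR written as a volume integral over directions, whose
analytic inputs are collected here).

* **Smooth parametric integrals, real version** (`hasFDerivAt_integral_kernel_mul_real`,
  `fderiv_integral_kernel_mul_apply_real`, `contDiff_integral_kernel_mul_real`,
  `laplacian_integral_kernel_mul_real`): for `A : E × M → ℝ` smooth, `m : Ω → M` a.e. bounded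
  and a.e. strongly measurable and `F ∈ L¹(ν)` on an arbitrary measure space,
  `X ↦ ∫ A (X, m y) F y dν` is `C^∞` with `D(∫ A F)(X) v = ∫ D A (X, m y) (v, 0) F y dν` and
  `Δ (∫ A F)(X) = ∫ (Δ_X A)(X, m y) F y dν` (a port to `ℝ` of
  `Literature.Analysis.Calculus.contDiff_integral_kernel_mul`, Dieudonné (8.11.2)).
* **The Poisson kernel** `PoissonBall.kernelFn R ξ ζ = (R² - ‖ξ‖²) (‖ξ - ζ‖²)^{-n/2}` of the
  ball `B(0, R)` (Gilbarg–Trudinger (2.29), without the constant `1/(n ω_n R)`, which the operator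
  of `PoissonBall.lean` replaces by a self-normalisation; `kernelFn_nonneg`, `kernelFn_map`,
  `kernelFn_le_of_le_norm_sub`), the globally smooth modification of its inverse-power factor
  (`PoissonBall.invPowFloor_props`: the singularity `‖ξ - ζ‖ = 0` floored with
  `Newtonian.smoothFloor`, equal to the factor where `‖ξ - ζ‖² > 2m`); **harmonicity in `ξ`**:
  `Δ_ξ kernelFn R (·) ζ = 0` at every `ξ ≠ ζ` when `‖ζ‖ = R`
  (`PoissonBall.laplacian_kernelFn_eq_zero`; the computation
  `Δ(ab) = aΔb + bΔa + 2⟪∇a, ∇b⟫` with `a = R² - ‖ξ‖²`, `b = ‖ξ - ζ‖^{-n}`: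
  `2n‖ξ-ζ‖^{-n-2}(R² - ‖ξ‖² - ‖ξ-ζ‖² + 2⟪ξ, ξ-ζ⟫) = 2n‖ξ-ζ‖^{-n-2}(R² - ‖ζ‖²) = 0`).

## References

* D. Gilbarg, N. S. Trudinger, *Elliptic Partial Differential Equations of Second Order*
  (Springer 2001), §2.5 (2.29), Thm. 2.6. [GilbargTrudinger2001]
* J. Dieudonné, *Foundations of Modern Analysis* (1960), (8.11.2). [folklore]
-/

noncomputable section

open MeasureTheory Metric Set Filter Function Module InnerProductSpace
open scoped Laplacian RealInnerProductSpace Topology ContDiff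

namespace Literature.Analysis.PDE

/-! ### Smooth parametric integrals (real-valued kernels) -/

section SmoothKernel

variable {E M : Type*} [NormedAddCommGroup E] [NormedSpace ℝ E] [FiniteDimensional ℝ E]
  [NormedAddCommGroup M] [NormedSpace ℝ M] [FiniteDimensional ℝ M]
  {Ω : Type*} [MeasurableSpace Ω] {ν : Measure Ω}

/-- The integrand `y ↦ A (X, m y) * F y` is integrable: `A (X, m y)` is a.e. bounded and a.e.
strongly measurable, `F ∈ L¹`. [folklore] -/
theorem integrable_kernel_mul_real {A : E × M → ℝ} (hA : Continuous A) {m : Ω → M}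
    (hm : AEStronglyMeasurable m ν) {R : ℝ} (hmR : ∀ᵐ y ∂ν, ‖m y‖ ≤ R) {F : Ω → ℝ}
    (hF : Integrable F ν) (X : E) : Integrable (fun y ↦ A (X, m y) * F y) ν := by
  obtain ⟨C, -, hC⟩ := Literature.Analysis.Calculus.exists_forall_norm_le_of_continuous_prod hA X 0 R
  refine hF.bdd_mul (c := C) (hA.comp_aestronglyMeasurable (aestronglyMeasurable_const.prodMk hm)) ?_
  filter_upwards [hmR] with y hy
  exact hC X (mem_closedBall_self le_rfl) (m y) (mem_closedBall_zero_iff.2 hy)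

/-- **Differentiation under the integral sign for a smooth real kernel.** For `A : E × M → ℝ`
of class `C^∞`, `m` a.e. bounded and `F ∈ L¹(ν)`, the function `X ↦ ∫ A (X, m y) F y dν` has
derivative `∫ F y • (D A (X, m y) ∘ inl) dν` at `X`. Dieudonné (1960), (8.11.2). [folklore] -/
theorem hasFDerivAt_integral_kernel_mul_real {A : E × M → ℝ} (hA : ContDiff ℝ ∞ A) {m : Ω → M}
    (hm : AEStronglyMeasurable m ν) {R : ℝ} (hmR : ∀ᵐ y ∂ν, ‖m y‖ ≤ R) {F : Ω → ℝ}
    (hF : Integrable F ν) (X₀ : E) :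
    Integrable (fun y ↦ F y • (fderiv ℝ A (X₀, m y)).comp (ContinuousLinearMap.inl ℝ E M)) ν ∧
    HasFDerivAt (fun X : E ↦ ∫ y, A (X, m y) * F y ∂ν)
      (∫ y, F y • (fderiv ℝ A (X₀, m y)).comp (ContinuousLinearMap.inl ℝ E M) ∂ν) X₀ := by
  have hAc : Continuous A := hA.continuous
  have hA1 : Differentiable ℝ A := hA.differentiable (by simp)
  have hDAc : Continuous (fderiv ℝ A) := hA.continuous_fderiv (by simp)
  obtain ⟨C, hC0, hC⟩ := Literature.Analysis.Calculus.exists_forall_norm_le_of_continuous_prod hDAc X₀ 1 R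
  set cinl : (E × M →L[ℝ] ℝ) →L[ℝ] (E →L[ℝ] ℝ) :=
    (ContinuousLinearMap.compL ℝ E (E × M) ℝ).flip (ContinuousLinearMap.inl ℝ E M) with hcinl
  have hcinl_apply : ∀ L : E × M →L[ℝ] ℝ, cinl L = L.comp (ContinuousLinearMap.inl ℝ E M) :=
    fun L ↦ rfl
  have hmeasA : ∀ X : E, AEStronglyMeasurable (fun y ↦ A (X, m y)) ν := fun X ↦
    hAc.comp_aestronglyMeasurable (aestronglyMeasurable_const.prodMk hm)
  have hmeasD : ∀ X : E, AEStronglyMeasurable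
      (fun y ↦ (fderiv ℝ A (X, m y)).comp (ContinuousLinearMap.inl ℝ E M)) ν := by
    intro X
    have h1 : AEStronglyMeasurable (fun y ↦ fderiv ℝ A (X, m y)) ν :=
      hDAc.comp_aestronglyMeasurable (aestronglyMeasurable_const.prodMk hm)
    simpa only [hcinl_apply] using cinl.continuous.comp_aestronglyMeasurable h1
  set F' : E → Ω → E →L[ℝ] ℝ := fun X y ↦
    F y • (fderiv ℝ A (X, m y)).comp (ContinuousLinearMap.inl ℝ E M) with hF'
  have hF'meas : ∀ X, AEStronglyMeasurable (F' X) ν := fun X ↦ hF.1.smul (hmeasD X)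
  have hbound : ∀ᵐ y ∂ν, ∀ X ∈ ball X₀ 1, ‖F' X y‖ ≤ C * ‖F y‖ := by
    filter_upwards [hmR] with y hy X hX
    rw [hF']
    dsimp only
    refine (norm_smul_le (F y)
      ((fderiv ℝ A (X, m y)).comp (ContinuousLinearMap.inl ℝ E M))).trans ?_
    rw [mul_comm]
    refine mul_le_mul_of_nonneg_right ?_ (norm_nonneg _)
    refine (ContinuousLinearMap.opNorm_comp_le _ _).trans ?_
    have h1 : ‖fderiv ℝ A (X, m y)‖ ≤ C :=
      hC X (ball_subset_closedBall hX) (m y) (mem_closedBall_zero_iff.2 hy)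
    calc ‖fderiv ℝ A (X, m y)‖ * ‖ContinuousLinearMap.inl ℝ E M‖
        ≤ C * 1 := mul_le_mul h1 (ContinuousLinearMap.norm_inl_le_one ℝ E M) (norm_nonneg _) hC0
      _ = C := mul_one C
  have hbound_int : Integrable (fun y ↦ C * ‖F y‖) ν := hF.norm.const_mul C
  have hdiff : ∀ᵐ y ∂ν, ∀ X ∈ ball X₀ 1,
      HasFDerivAt (fun X : E ↦ A (X, m y) * F y) (F' X y) X := by
    refine Eventually.of_forall fun y X _ ↦ ?_
    have h1 : HasFDerivAt (fun X : E ↦ A (X, m y))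
        ((fderiv ℝ A (X, m y)).comp (ContinuousLinearMap.inl ℝ E M)) X :=
      (hA1 (X, m y)).hasFDerivAt.comp X (hasFDerivAt_prodMk_left X (m y))
    simpa only [hF'] using h1.mul_const (F y)
  have hint₀ : Integrable (fun y ↦ A (X₀, m y) * F y) ν := integrable_kernel_mul_real hAc hm hmR hF X₀
  have key := hasFDerivAt_integral_of_dominated_of_fderiv_le (F' := F')
    (bound := fun y ↦ C * ‖F y‖) (ball_mem_nhds X₀ zero_lt_one)
    (Eventually.of_forall fun X ↦ (hmeasA X).mul hF.1) hint₀ (hF'meas X₀) hbound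
    hbound_int hdiff
  refine ⟨?_, key⟩
  refine hbound_int.mono' (hF'meas X₀) ?_
  filter_upwards [hbound] with y hy
  exact hy X₀ (mem_ball_self zero_lt_one)

/-- **The directional derivative formula**: `D(X ↦ ∫ A (X, m y) F y dν)(X) v =
∫ D A (X, m y) (v, 0) F y dν`. [folklore] -/
theorem fderiv_integral_kernel_mul_apply_real {A : E × M → ℝ} (hA : ContDiff ℝ ∞ A) {m : Ω → M}
    (hm : AEStronglyMeasurable m ν) {R : ℝ} (hmR : ∀ᵐ y ∂ν, ‖m y‖ ≤ R) {F : Ω → ℝ}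
    (hF : Integrable F ν) (X : E) (v : E) :
    fderiv ℝ (fun X : E ↦ ∫ y, A (X, m y) * F y ∂ν) X v =
      ∫ y, fderiv ℝ A (X, m y) (v, 0) * F y ∂ν := by
  obtain ⟨hint, hderiv⟩ := hasFDerivAt_integral_kernel_mul_real hA hm hmR hF X
  rw [hderiv.fderiv, ContinuousLinearMap.integral_apply hint v]
  refine integral_congr_ae (Eventually.of_forall fun y ↦ ?_)
  show (F y • (fderiv ℝ A (X, m y)).comp (ContinuousLinearMap.inl ℝ E M)) v =
    fderiv ℝ A (X, m y) (v, 0) * F y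
  rw [show (F y • (fderiv ℝ A (X, m y)).comp (ContinuousLinearMap.inl ℝ E M)) v =
      F y • ((fderiv ℝ A (X, m y)).comp (ContinuousLinearMap.inl ℝ E M) v) from rfl,
    ContinuousLinearMap.comp_apply, ContinuousLinearMap.inl_apply, smul_eq_mul, mul_comm]

/-- **Smoothness of integrals against a smooth real kernel**: `X ↦ ∫ A (X, m y) F y dν` is
`C^∞` on `E`. [folklore] -/
theorem contDiff_integral_kernel_mul_real {A : E × M → ℝ} (hA : ContDiff ℝ ∞ A) {m : Ω → M}
    (hm : AEStronglyMeasurable m ν) {R : ℝ} (hmR : ∀ᵐ y ∂ν, ‖m y‖ ≤ R) {F : Ω → ℝ}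
    (hF : Integrable F ν) :
    ContDiff ℝ ∞ (fun X : E ↦ ∫ y, A (X, m y) * F y ∂ν) := by
  have key : ∀ (k : ℕ) (A : E × M → ℝ), ContDiff ℝ ∞ A →
      ContDiff ℝ k (fun X : E ↦ ∫ y, A (X, m y) * F y ∂ν) := by
    intro k
    induction k with
    | zero =>
      intro A hA
      exact contDiff_zero.2 (continuous_iff_continuousAt.2 fun X ↦
        (hasFDerivAt_integral_kernel_mul_real hA hm hmR hF X).2.continuousAt)
    | succ k ih =>
      intro A hA
      rw [show ((k + 1 : ℕ) : WithTop ℕ∞) = (k : WithTop ℕ∞) + 1 by push_cast; rfl,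
        contDiff_succ_iff_fderiv_apply]
      refine ⟨fun X ↦ (hasFDerivAt_integral_kernel_mul_real hA hm hmR hF X).2.differentiableAt,
        fun h ↦ absurd h (by exact_mod_cast WithTop.natCast_ne_top k), fun v ↦ ?_⟩
      have heq : (fun X ↦ fderiv ℝ (fun X : E ↦ ∫ y, A (X, m y) * F y ∂ν) X v) =
          fun X ↦ ∫ y, (fun p : E × M ↦ fderiv ℝ A p (v, 0)) (X, m y) * F y ∂ν :=
        funext fun X ↦ fderiv_integral_kernel_mul_apply_real hA hm hmR hF X v
      rw [heq]
      exact ih _ ((hA.fderiv_right le_rfl).clm_apply contDiff_const)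
  exact contDiff_infty.2 fun k ↦ key k A hA

end SmoothKernel

/-! ### The Laplacian under the integral sign -/

section LaplacianKernel

variable {E M : Type*} [NormedAddCommGroup E] [InnerProductSpace ℝ E] [FiniteDimensional ℝ E]
  [NormedAddCommGroup M] [NormedSpace ℝ M] [FiniteDimensional ℝ M]
  {Ω : Type*} [MeasurableSpace Ω] {ν : Measure Ω}

/-- The `X`-Laplacian of a kernel `A : E × M → ℝ`, as a kernel: with an orthonormal basis `b`,
`Δ₁A (X, θ) = Σᵢ D(p ↦ D A p (bᵢ, 0)) (X, θ) (bᵢ, 0)`. [folklore] -/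
def kernelLaplacian (A : E × M → ℝ) (p : E × M) : ℝ :=
  ∑ i, fderiv ℝ (fun q : E × M => fderiv ℝ A q (stdOrthonormalBasis ℝ E i, 0)) p
    (stdOrthonormalBasis ℝ E i, 0)

omit [FiniteDimensional ℝ M] in
/-- For a smooth kernel, `Δ (X ↦ A (X, θ)) X = kernelLaplacian A (X, θ)`. [folklore] -/
theorem laplacian_curry_eq_kernelLaplacian {A : E × M → ℝ} (hA : ContDiff ℝ ∞ A) (X : E) (θ : M) :
    (Δ (fun X : E => A (X, θ))) X = kernelLaplacian A (X, θ) := by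
  set b := stdOrthonormalBasis ℝ E with hb
  have hA2 : ContDiff ℝ 2 fun X : E => A (X, θ) :=
    (contDiff_infty.1 hA 2).comp (contDiff_prodMk_left θ)
  rw [Literature.Analysis.FluidPDE.laplacian_eq_sum_fderiv_fderiv b hA2 X]
  unfold kernelLaplacian
  refine Finset.sum_congr rfl fun i _ => ?_
  have hA1 : Differentiable ℝ A := hA.differentiable (by simp)
  have hAi : Differentiable ℝ fun q : E × M => fderiv ℝ A q (b i, 0) :=
    (((contDiff_infty.1 hA 2).fderiv_right (m := 1) le_rfl).clm_apply contDiff_const).differentiable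
      one_ne_zero
  -- first derivatives along the slice
  have h1 : ∀ Y : E, fderiv ℝ (fun X : E => A (X, θ)) Y (b i) = fderiv ℝ A (Y, θ) (b i, 0) := by
    intro Y
    have : HasFDerivAt (fun X : E => A (X, θ))
        ((fderiv ℝ A (Y, θ)).comp (ContinuousLinearMap.inl ℝ E M)) Y :=
      (hA1 (Y, θ)).hasFDerivAt.comp Y (hasFDerivAt_prodMk_left (𝕜 := ℝ) Y θ)
    rw [this.fderiv]
    simp
  simp_rw [h1]
  have h2' := (hAi (X, θ)).hasFDerivAt.comp X (hasFDerivAt_prodMk_left (𝕜 := ℝ) X θ)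
  have h2 : HasFDerivAt (fun Y : E => fderiv ℝ A (Y, θ) (b i, 0))
      ((fderiv ℝ (fun q : E × M => fderiv ℝ A q (b i, 0)) (X, θ)).comp
        (ContinuousLinearMap.inl ℝ E M)) X := h2'
  rw [h2.fderiv]
  simp [hb]

/-- **The Laplacian passes under the integral for a smooth real kernel**:
`Δ (X ↦ ∫ A (X, m y) F y dν)(X) = ∫ (Δ₁ A)(X, m y) F y dν`. [folklore] -/
theorem laplacian_integral_kernel_mul_real {A : E × M → ℝ} (hA : ContDiff ℝ ∞ A) {m : Ω → M}
    (hm : AEStronglyMeasurable m ν) {R : ℝ} (hmR : ∀ᵐ y ∂ν, ‖m y‖ ≤ R) {F : Ω → ℝ}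
    (hF : Integrable F ν) (X : E) :
    (Δ (fun X : E => ∫ y, A (X, m y) * F y ∂ν)) X = ∫ y, kernelLaplacian A (X, m y) * F y ∂ν := by
  set b := stdOrthonormalBasis ℝ E with hb
  have hQ : ContDiff ℝ 2 fun X : E => ∫ y, A (X, m y) * F y ∂ν :=
    contDiff_infty.1 (contDiff_integral_kernel_mul_real hA hm hmR hF) 2
  rw [Literature.Analysis.FluidPDE.laplacian_eq_sum_fderiv_fderiv b hQ X]
  have hAi : ∀ i, ContDiff ℝ ∞ fun q : E × M => fderiv ℝ A q (b i, 0) := fun i =>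
    (hA.fderiv_right le_rfl).clm_apply contDiff_const
  have h1 : ∀ i, (fun Y => fderiv ℝ (fun X : E => ∫ y, A (X, m y) * F y ∂ν) Y (b i)) =
      fun Y => ∫ y, (fun q : E × M => fderiv ℝ A q (b i, 0)) (Y, m y) * F y ∂ν := fun i =>
    funext fun Y => fderiv_integral_kernel_mul_apply_real hA hm hmR hF Y (b i)
  simp_rw [h1]
  have h2 : ∀ i, fderiv ℝ (fun Y => ∫ y, (fun q : E × M => fderiv ℝ A q (b i, 0)) (Y, m y) * F y ∂ν)
      X (b i) = ∫ y, fderiv ℝ (fun q : E × M => fderiv ℝ A q (b i, 0)) (X, m y) (b i, 0) * F y ∂ν :=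
    fun i => fderiv_integral_kernel_mul_apply_real (hAi i) hm hmR hF X (b i)
  simp_rw [h2]
  rw [← integral_finsetSum]
  · refine integral_congr_ae (Eventually.of_forall fun y => ?_)
    simp only [kernelLaplacian, Finset.sum_mul, hb]
  · intro i _
    have hc : Continuous fun q : E × M => fderiv ℝ (fun q : E × M => fderiv ℝ A q (b i, 0)) q (b i, 0) :=
      (((contDiff_infty.1 (hAi i) 1).fderiv_right (m := 0) le_rfl).clm_apply contDiff_const).continuous
    exact integrable_kernel_mul_real hc hm hmR hF X

end LaplacianKernel

/-! ### The Poisson kernel of the ball `B(0, R)` and its harmonicity -/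

namespace PoissonBall

variable {E : Type*} [NormedAddCommGroup E] [InnerProductSpace ℝ E] [FiniteDimensional ℝ E]

variable (E) in
/-- Half the dimension, `p = n/2`, the exponent of `‖ξ - ζ‖^{-n} = (‖ξ - ζ‖²)^{-p}`. [folklore] -/
def halfDim : ℝ := (finrank ℝ E : ℝ) / 2

/-- **The Poisson kernel of the ball `B(0,R)`** (up to the constant `(n ω_n R)⁻¹`):
`K_R(ξ, ζ) = (R² - ‖ξ‖²) ‖ξ - ζ‖^{-n}` (Gilbarg–Trudinger (2.29); junk `0` at `ξ = ζ`).
[cite: GilbargTrudinger2001, (2.29)] -/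
def kernelFn (R : ℝ) (ξ ζ : E) : ℝ := (R ^ 2 - ‖ξ‖ ^ 2) * (‖ξ - ζ‖ ^ 2) ^ (-halfDim E)

omit [FiniteDimensional ℝ E] in
/-- The kernel is nonnegative for `‖ξ‖ ≤ R`. [folklore] -/
theorem kernelFn_nonneg {R : ℝ} {ξ : E} (hξ : ‖ξ‖ ≤ R) (ζ : E) : 0 ≤ kernelFn R ξ ζ := by
  unfold kernelFn
  have : ‖ξ‖ ^ 2 ≤ R ^ 2 := pow_le_pow_left₀ (norm_nonneg _) hξ 2
  exact mul_nonneg (by linarith) (Real.rpow_nonneg (by positivity) _)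

omit [FiniteDimensional ℝ E] in
/-- The kernel at the centre: `K_R(0, ζ) = R² (‖ζ‖²)^{-n/2}`. [folklore] -/
theorem kernelFn_zero_left (R : ℝ) (ζ : E) : kernelFn R 0 ζ = R ^ 2 * (‖ζ‖ ^ 2) ^ (-halfDim E) := by
  simp [kernelFn]

omit [FiniteDimensional ℝ E] in
/-- Invariance of the kernel under linear isometries: `K(Lξ, Lζ) = K(ξ, ζ)`. [folklore] -/
theorem kernelFn_map (R : ℝ) (L : E ≃ₗᵢ[ℝ] E) (ξ ζ : E) :
    kernelFn R (L ξ) (L ζ) = kernelFn R ξ ζ := by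
  simp only [kernelFn, LinearIsometryEquiv.norm_map, ← map_sub]

omit [FiniteDimensional ℝ E] in
/-- The bound `K_R(ξ, ζ) ≤ (R² - ‖ξ‖²) δ^{-n}` when `‖ξ - ζ‖ ≥ δ > 0`, `‖ξ‖ ≤ R`. [folklore] -/
theorem kernelFn_le_of_le_norm_sub {R δ : ℝ} {ξ ζ : E} (hξ : ‖ξ‖ ≤ R) (hδ : 0 < δ)
    (h : δ ≤ ‖ξ - ζ‖) : kernelFn R ξ ζ ≤ (R ^ 2 - ‖ξ‖ ^ 2) * (δ ^ 2) ^ (-halfDim E) := by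
  unfold kernelFn
  have h1 : ‖ξ‖ ^ 2 ≤ R ^ 2 := pow_le_pow_left₀ (norm_nonneg _) hξ 2
  have hp : -halfDim E ≤ 0 := by
    unfold halfDim
    have : (0 : ℝ) ≤ finrank ℝ E := Nat.cast_nonneg _
    linarith
  refine mul_le_mul_of_nonneg_left ?_ (by linarith)
  exact Real.rpow_le_rpow_of_nonpos (by positivity) (pow_le_pow_left₀ hδ.le h 2) hp

/-! #### The computation `Δ_ξ K_R(·, ζ) = 0` for `‖ζ‖ = R` -/

/-- `d/dσ σ^{-p} = -p σ^{-p-1}` for `σ > 0`. [folklore] -/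
theorem hasDerivAt_rpow_neg (p : ℝ) {σ : ℝ} (hσ : 0 < σ) :
    HasDerivAt (fun τ : ℝ => τ ^ (-p)) (-p * σ ^ (-p - 1)) σ := by
  have := Real.hasDerivAt_rpow_const (x := σ) (p := -p) (Or.inl hσ.ne')
  exact this.congr_deriv (by ring_nf)

/-- The inverse-power factor `b(w) = (‖w - ζ‖²)^{-p}`: its value of the Laplacian and of the
derivative at `ξ ≠ ζ`: `Δb(ξ) = 4p (‖ξ-ζ‖²)^{-p-1}` (for `n = 2p`) and
`Db(ξ) = -2p (‖ξ-ζ‖²)^{-p-1} ⟪ξ - ζ, ·⟫`. [folklore] -/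
theorem laplacian_and_fderiv_invPow (ζ : E) {ξ : E} (hξ : ξ ≠ ζ) :
    (Δ (fun w : E => (‖w - ζ‖ ^ 2) ^ (-halfDim E))) ξ =
        4 * halfDim E * (‖ξ - ζ‖ ^ 2) ^ (-halfDim E - 1) ∧
      fderiv ℝ (fun w : E => (‖w - ζ‖ ^ 2) ^ (-halfDim E)) ξ =
        (2 * (-halfDim E * (‖ξ - ζ‖ ^ 2) ^ (-halfDim E - 1))) • (innerSL ℝ (ξ - ζ) : E →L[ℝ] ℝ) := by
  set p : ℝ := halfDim E with hp
  set z : E := ξ - ζ with hz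
  have hz0 : z ≠ 0 := sub_ne_zero.2 hξ
  have hs : 0 < ‖z‖ ^ 2 := by positivity
  set G : ℝ → ℝ := fun τ => τ ^ (-p) with hG
  have hGd : ∀ σ ∈ Ioi (0 : ℝ), HasDerivAt G (-p * σ ^ (-p - 1)) σ := fun σ hσ =>
    hasDerivAt_rpow_neg p hσ
  have hG₁ : HasDerivAt (fun σ : ℝ => -p * σ ^ (-p - 1)) (-p * (-(p + 1) * (‖z‖ ^ 2) ^ (-(p + 1) - 1)))
      (‖z‖ ^ 2) := by
    have h := hasDerivAt_rpow_neg (p + 1) hs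
    have h' : HasDerivAt (fun σ : ℝ => σ ^ (-p - 1)) (-(p + 1) * (‖z‖ ^ 2) ^ (-(p + 1) - 1)) (‖z‖ ^ 2) := by
      have e : (fun σ : ℝ => σ ^ (-p - 1)) = fun σ : ℝ => σ ^ (-(p + 1)) := by
        funext σ; congr 1; ring
      rw [e]; exact h
    exact h'.const_mul (-p)
  constructor
  · rw [LoewnerNirenberg.laplacian_translate_sub (fun w : E => (‖w‖ ^ 2) ^ (-p)) ζ ξ]
    have key := Literature.Analysis.FluidPDE.laplacian_comp_norm_sq (E := E) (g := G) isOpen_Ioi hGd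
      (z := z) hs hG₁
    simp only [hG] at key
    rw [← hz, key]
    have e1 : (‖z‖ ^ 2) ^ (-(p + 1) - 1) * ‖z‖ ^ 2 = (‖z‖ ^ 2) ^ (-p - 1) := by
      rw [show (-(p + 1) - 1 : ℝ) = (-p - 1) - 1 by ring, Real.rpow_sub_one hs.ne']
      field_simp
    have hn : (finrank ℝ E : ℝ) = 2 * p := by rw [hp, halfDim]; ring
    rw [hn]
    calc 4 * (-p * (-(p + 1) * (‖z‖ ^ 2) ^ (-(p + 1) - 1))) * ‖z‖ ^ 2 +
          2 * (2 * p) * (-p * (‖z‖ ^ 2) ^ (-p - 1))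
        = 4 * p * (p + 1) * ((‖z‖ ^ 2) ^ (-(p + 1) - 1) * ‖z‖ ^ 2) -
            4 * p * p * (‖z‖ ^ 2) ^ (-p - 1) := by ring
      _ = 4 * p * (‖z‖ ^ 2) ^ (-p - 1) := by rw [e1]; ring
  · have h1 : fderiv ℝ (fun w : E => (‖w - ζ‖ ^ 2) ^ (-p)) ξ =
        fderiv ℝ (fun w : E => (‖w‖ ^ 2) ^ (-p)) (ξ - ζ) :=
      fderiv_comp_sub (𝕜 := ℝ) (f := fun w : E => (‖w‖ ^ 2) ^ (-p)) (x := ξ) ζ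
    rw [h1, ← hz]
    exact (Literature.Analysis.FluidPDE.hasFDerivAt_comp_norm_sq (hGd (‖z‖ ^ 2) hs)).fderiv

/-- The polynomial factor `a(w) = R² - ‖w‖²`: `Δa = -2n`, `Da(ξ) = -2⟪ξ, ·⟫`, and `a` is
smooth. [folklore] -/
theorem laplacian_and_fderiv_poly (R : ℝ) (ξ : E) :
    (Δ (fun w : E => R ^ 2 - ‖w‖ ^ 2)) ξ = -(2 * (finrank ℝ E : ℝ)) ∧
      fderiv ℝ (fun w : E => R ^ 2 - ‖w‖ ^ 2) ξ = (2 * (-1 : ℝ)) • (innerSL ℝ ξ : E →L[ℝ] ℝ) := by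
  have hg : ∀ σ ∈ (univ : Set ℝ), HasDerivAt (fun τ : ℝ => R ^ 2 - τ) (-1) σ := fun σ _ => by
    simpa using (hasDerivAt_id σ).const_sub (R ^ 2)
  have hg₁ : HasDerivAt (fun _ : ℝ => (-1 : ℝ)) 0 (‖ξ‖ ^ 2) := hasDerivAt_const _ _
  constructor
  · have key := Literature.Analysis.FluidPDE.laplacian_comp_norm_sq (E := E)
      (g := fun τ : ℝ => R ^ 2 - τ) isOpen_univ hg (z := ξ) (mem_univ _) hg₁
    rw [key]; ring
  · exact (Literature.Analysis.FluidPDE.hasFDerivAt_comp_norm_sq (hg (‖ξ‖ ^ 2) (mem_univ _))).fderiv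

omit [FiniteDimensional ℝ E] in
/-- The globally smooth modification `b_m(w) = (smoothFloor m (‖w - ζ‖²))^{-p}` of the
inverse-power factor (`m > 0`): smooth, and equal to `b` near every `ξ` with `‖ξ - ζ‖² > 2m`.
[folklore] -/
theorem invPowFloor_props {m : ℝ} (hm : 0 < m) (ζ : E) :
    ContDiff ℝ 2 (fun w : E => (Newtonian.smoothFloor m (‖w - ζ‖ ^ 2)) ^ (-halfDim E)) ∧
      ∀ {ξ : E}, 2 * m < ‖ξ - ζ‖ ^ 2 →
        (fun w : E => (Newtonian.smoothFloor m (‖w - ζ‖ ^ 2)) ^ (-halfDim E)) =ᶠ[𝓝 ξ]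
          fun w : E => (‖w - ζ‖ ^ 2) ^ (-halfDim E) := by
  constructor
  · have h1 : ContDiff ℝ 2 fun w : E => Newtonian.smoothFloor m (‖w - ζ‖ ^ 2) :=
      (Newtonian.contDiff_smoothFloor m).comp ((contDiff_norm_sq ℝ).comp (contDiff_id.sub contDiff_const))
    exact h1.rpow_const_of_ne fun w => (hm.trans_le (Newtonian.le_smoothFloor hm _)).ne'
  · intro ξ hξ
    have ho : IsOpen {w : E | 2 * m < ‖w - ζ‖ ^ 2} := isOpen_lt continuous_const (by fun_prop)
    filter_upwards [ho.mem_nhds hξ] with w hw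
    simp only [Newtonian.smoothFloor_eq_self hm (le_of_lt hw)]

/-- **Harmonicity of the Poisson kernel in the first variable**: for `‖ζ‖ = R` and `ξ ≠ ζ`,
`Δ_ξ K_R(·, ζ) = 0` (`Δ(ab) = aΔb + bΔa + 2⟪∇a,∇b⟫ = 4p‖ξ-ζ‖^{-n-2}(R² - ‖ζ‖²) = 0`;
Gilbarg–Trudinger, proof of Thm. 2.6). [cite: GilbargTrudinger2001, Thm. 2.6 (proof)] -/
theorem laplacian_kernelFn_eq_zero {R : ℝ} {ζ ξ : E} (hζ : ‖ζ‖ = R) (hξ : ξ ≠ ζ) :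
    (Δ (fun w : E => kernelFn R w ζ)) ξ = 0 := by
  set p : ℝ := halfDim E with hp
  have hs : 0 < ‖ξ - ζ‖ ^ 2 := by have := sub_ne_zero.2 hξ; positivity
  -- smooth modification of `b` agreeing with it near `ξ`
  set m : ℝ := ‖ξ - ζ‖ ^ 2 / 4 with hm
  have hm0 : 0 < m := by positivity
  have h2m : 2 * m < ‖ξ - ζ‖ ^ 2 := by rw [hm]; linarith
  obtain ⟨hbm, hbmeq⟩ := invPowFloor_props hm0 ζ
  have hev := hbmeq h2m
  set a : E → ℝ := fun w => R ^ 2 - ‖w‖ ^ 2 with ha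
  set b : E → ℝ := fun w => (‖w - ζ‖ ^ 2) ^ (-p) with hb
  set bm : E → ℝ := fun w => (Newtonian.smoothFloor m (‖w - ζ‖ ^ 2)) ^ (-p) with hbm'
  have ha2 : ContDiff ℝ 2 a := contDiff_const.sub (contDiff_norm_sq ℝ)
  -- `K = a * b` agrees with `a * bm` near `ξ`
  have hK : (fun w : E => kernelFn R w ζ) =ᶠ[𝓝 ξ] fun w => a w * bm w := by
    filter_upwards [hev] with w hw
    show kernelFn R w ζ = a w * bm w
    rw [hw]
    rfl
  rw [(InnerProductSpace.laplacian_congr_nhds hK).eq_of_nhds,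
    Literature.Analysis.FluidPDE.laplacian_mul_eq (stdOrthonormalBasis ℝ E) ha2 hbm ξ]
  -- replace `bm` by `b` at `ξ`
  have hbmξ : bm ξ = b ξ := hev.eq_of_nhds
  have hΔbm : (Δ bm) ξ = (Δ b) ξ := (InnerProductSpace.laplacian_congr_nhds hev).eq_of_nhds
  have hDbm : fderiv ℝ bm ξ = fderiv ℝ b ξ := hev.fderiv_eq
  rw [hbmξ, hΔbm, hDbm]
  -- the values
  obtain ⟨hΔb, hDb⟩ := laplacian_and_fderiv_invPow ζ hξ
  obtain ⟨hΔa, hDa⟩ := laplacian_and_fderiv_poly R ξ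
  rw [← hp] at hΔb hDb
  simp only [hb, ha]
  rw [hΔb, hΔa, hDb, hDa]
  simp only [FunLike.coe_smul, Pi.smul_apply, smul_eq_mul,
    Literature.Analysis.FluidPDE.innerSL_real_coe_apply_apply]
  -- the cross term `Σᵢ ⟪ξ, eᵢ⟫ ⟪ξ - ζ, eᵢ⟫ = ⟪ξ, ξ - ζ⟫`
  have hsum : ∑ i, 2 * (-1 : ℝ) * ⟪ξ, stdOrthonormalBasis ℝ E i⟫ *
      (2 * (-p * (‖ξ - ζ‖ ^ 2) ^ (-p - 1)) * ⟪ξ - ζ, stdOrthonormalBasis ℝ E i⟫) =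
      2 * (-1 : ℝ) * (2 * (-p * (‖ξ - ζ‖ ^ 2) ^ (-p - 1))) * ⟪ξ, ξ - ζ⟫ := by
    rw [← (stdOrthonormalBasis ℝ E).sum_inner_mul_inner ξ (ξ - ζ), Finset.mul_sum]
    refine Finset.sum_congr rfl fun i _ => ?_
    rw [real_inner_comm (ξ - ζ)]
    ring
  rw [hsum]
  -- algebra: everything is `(‖ξ-ζ‖²)^{-p-1}` times a polynomial that vanishes as `‖ζ‖ = R`
  have e1 : (‖ξ - ζ‖ ^ 2) ^ (-p) = (‖ξ - ζ‖ ^ 2) ^ (-p - 1) * ‖ξ - ζ‖ ^ 2 := by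
    rw [show (-p : ℝ) = (-p - 1) + 1 by ring, Real.rpow_add_one hs.ne']
    ring_nf
  have hn : (finrank ℝ E : ℝ) = 2 * p := by rw [hp, halfDim]; ring
  have hsq : ‖ξ - ζ‖ ^ 2 = ‖ξ‖ ^ 2 - 2 * ⟪ξ, ζ⟫ + ‖ζ‖ ^ 2 := norm_sub_sq_real ξ ζ
  have hin : ⟪ξ, ξ - ζ⟫ = ‖ξ‖ ^ 2 - ⟪ξ, ζ⟫ := by
    rw [inner_sub_right, real_inner_self_eq_norm_sq]
  rw [e1, hn, hin]
  set t : ℝ := (‖ξ - ζ‖ ^ 2) ^ (-p - 1) with ht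
  rw [hsq, hζ]
  ring

end PoissonBall

end Literature.Analysis.PDE
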